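import Literature.MathematicalPhysics.QuantumFieldTheory.Balaban1983to89.B11Ineq189LeafCkLocal
import Literature.MathematicalPhysics.QuantumFieldTheory.Balaban1983to89.B11Ineq189HasMaj2Kernel
import Literature.MathematicalPhysics.QuantumFieldTheory.Balaban1983to89.B11Ineq73HasMajConcrete

/-!
# `Balaban1983to89.B11Ineq189LeafCkHasMaj2` — T. Bałaban, *The variational problem and background fields in renormalization group method for
# lattice gauge theories*, Commun. Math. Phys. **102** (1985) 277–309 [Balaban1985Variational], (189) p. 308: THE LOCAL ANALYTIC LEAF OF THE
# (189) CENSUS FOR BAŁABAN'S `C_k` AS A GENUINE MULTI-BLOCK MAJORANT — `HasMaj₂` of the second derivative `(δ²/δA²)C_k(U′U₀, ·)` between the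
# concrete sup sizes over the single-scale cube geometry of the `ℤᵈ` carrier, kernel `9C₂·(dL^{kd})²·𝟙[|y′ − y|₁ ≤ 1]·𝟙[|y″ − y|₁ ≤ 1]`

statement-level skeleton of published theorems with citation tags; proofs where landed; nothing here is a claim about the Yang–Mills mass gap

PDF held: `paper:balaban1985-cmp102-variational-background` (journal page = PDF page + 276), p. 308 [PDF 32] (*«for supp 𝔄 ⊂ Δ̃(y′) … y ∈ Λ_j»*);
`paper:balaban1985-cmp98-averaging` p. 24 (locality), p. 38 (134)–(135), p. 43 Prop. 7.

CITATION HEADER (lean-in-tree rule 2026-08-18).  WHAT IS REPRODUCED: SKELETON row **B11.Eq189** (GAPS G-B11-G2, the author-omitted second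
differentiation; cell census `SECOND-DERIVATIVE-189.md` §4: *«LEAF BOUND |Φ_c[u, v]| ≤ 9C₂|u|_∞|v|_∞ with u, v restricted to B(c) — LOCAL, no ε»*
and §5 SHAPE-L: *«K(y, y″, y′) = O(1)·C₂·exp(−δ d(y, y′))·exp(−δ d(y, y″))»*).  This file COMPOSES three landed pieces of this seat — the leaf
in local norms (`B11Ineq189LeafCkLocal.norm_d2_Ck_ins_local`), the bilinear dictionary (`B11Ineq189HasMaj2Kernel.hasMaj₂_supSize_of_kernel`) —
with p06/r08's cube geometry and sup sizes of the (73)/(190) chain of record (`B11Ineq73HasMajConcrete.cubeGeometry`, `blkS`, `boxS`, `blkT`,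
`boxT`, `card_filter_cube_le`; `B11SupSize190.supSize`) into the block-majorant currency `B11Ineq189.HasMaj₂` of the census.

WHAT IS CERTIFIED (kernel, sorry-free; standard axioms; theorems only), under the DATA of `B11Ineq189LeafCk` (= `B7Prop7Ck`'s; `𝔸 : Type`):
§1 `l1_cube_sub_le_one` — a fine bond of the box `B(c) = Bᵏ(c₋) ∪ Bᵏ(c₊)` of the coarse bond `c = (z, κ)` has its cube within `ℓ¹`-distance 1
   of `z` (integer-division bookkeeping); `norm_boxProj_single_le` — `‖P_c(e_a v)‖ ≤ 𝟙[a ∈ B(c)]‖v‖`.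
§2 `differentiableAt_Ck_ins_of_box`, **`norm_fderiv_fderiv_Ck_ins_local`** — the leaf for the second FRÉCHET derivative under box smallness:
   `‖P_c X‖ < ρ/3 ⟹ ‖D²C_k(·)(c)(X) u v‖ ≤ 9C₂‖P_c u‖‖P_c v‖`.
§3 **`hasMaj₂_d2_Ck_ins`** — for every centre `X ∈ 𝔸^S` small on every box (`∀ c ∈ T′, ‖P_c X‖ < ρ/3`) and every ℝ-bilinear `Φ` AGREEING with
   the second derivative (`Φ v μ c = D²C_k(·)(c)(X) v μ`, the consumer's packaging): `HasMaj₂ (supSize g boxS blkS) (supSize g boxS blkS)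
   (supSize g boxT blkT) Φ K` over `g = cubeGeometry L k S T′` with `K(y, y″, y′) = 9C₂·(d(Lᵏ)ᵈ)²·𝟙[|y′ − y|₁ ≤ 1]·𝟙[|y″ − y|₁ ≤ 1]`
   (`C₂ = 8C₁′e^{E}L^{2k}`); `hasMaj₂_d2_Ck_ins_exp` — the same dressed as `9C₂(dL^{kd})²e^{2δ}·e^{−δ d(y,y″)}·e^{−δ d(y,y′)}` for any `δ ≥ 0`
   (SHAPE-L's printed form); **`exists_hasMaj₂_d2_Ck_ins`** — the hypothesis-free packaging: the second derivatives assemble into an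
   ℝ-bilinear `Φ` (bilinearity of `D²`) carrying that majorant (appended 2026-08-26).

HONEST SCOPE.  The carrier is [4]'s `ℤᵈ` insertion space at ONE scale (the (73)/(190) chain's reading; no torus, no multi-scale `Λ_j` family);
the count `d(Lᵏ)ᵈ` per cube is the tree's `card_filter_cube_le`; the thresholds are r04's explicit witnesses; `Φ` is any bilinear packaging of
the second derivative (none is constructed here).  (189) stays the located leaf (G-B11-G2): this is its local leaf for `C_k` in the census's own
currency, not the sixteen-term assembly.  Seat pub-ymgap-dag-n07-b (HUMAN RULING D-0062, node N07 [B11]).  Imports `B11Ineq189LeafCkLocal`,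
`B11Ineq189HasMaj2Kernel`, `B11Ineq73HasMajConcrete`; no definition, no new named fact.
-/

noncomputable section

open scoped BigOperators Topology
open NormedSpace Metric Set Finset Filter

namespace Literature.MathematicalPhysics.QuantumFieldTheory.Balaban1983to89.B11Ineq189LeafCkHasMaj2

open Literature.MathematicalPhysics.QuantumFieldTheory.Balaban1983to89
open B7Prop1Explicit B7Prop1Local B7Prop2Explicit B7Prop3Flat MatrixLog B7Eq92Concrete B7Prop3GeneralAnalytic B7Prop3GeneralLinear
  B7Prop4GeneralLevels B7Prop5GeneralInduction B7Prop7OneStep B7Prop7Levels B7Prop7Ins B7Prop7Ck B11Ineq189LocalLeaf B11Ineq189LeafCk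
  B11Ineq189LeafCkLocal B9Ineq3137LocalSup B11SectG B11SupSize190 B11Ineq189 B11Ineq189HasMaj2Kernel B11Ineq73HasMajConcrete

/-! ## §1 Box bookkeeping on `ℤᵈ` -/

section Geometry

variable {d : ℕ}

/-- **A fine bond of the box of the coarse bond `c = (z, κ)` has its `Lᵏ`-cube within `ℓ¹`-distance 1 of `z`** (the box is the union of the
two cubes `z` and `z + e_κ`). [cite: Balaban1985Averaging, p.24 (after (43))] -/
theorem l1_cube_sub_le_one {L : ℕ} (hL : 1 ≤ L) (k : ℕ) (z : B7Prop1Explicit.Site d) (κ : Fin d) {x : B7Prop1Explicit.Site d}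
    (hx : InBox (loK L k z) (bondHiK L k z κ) x) : B7Prop1Explicit.l1 (cube L k x - z) ≤ 1 := by
  have hLk : (0 : ℤ) < (L : ℤ) ^ k := by positivity
  have hcoord : ∀ i, 0 ≤ (cube L k x - z) i ∧ (cube L k x - z) i ≤ if i = κ then 1 else 0 := by
    intro i
    have hlo := (hx i).1
    have hhi := (hx i).2
    simp only [loK] at hlo
    simp only [bondHiK] at hhi
    have h1 : z i ≤ x i / (L : ℤ) ^ k := Int.le_ediv_of_mul_le hLk (by linarith [mul_comm ((L : ℤ) ^ k) (z i)])
    have h2 : x i / (L : ℤ) ^ k < z i + (if i = κ then 1 else 0) + 1 := by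
      rw [Int.ediv_lt_iff_lt_mul hLk]
      split_ifs at hhi ⊢ <;> nlinarith
    refine ⟨?_, ?_⟩
    · show 0 ≤ x i / (L : ℤ) ^ k - z i
      linarith
    · show x i / (L : ℤ) ^ k - z i ≤ _
      linarith
  have hnat : ∀ i, ((cube L k x - z) i).natAbs ≤ if i = κ then 1 else 0 := by
    intro i
    have h := hcoord i
    have hcast : (((cube L k x - z) i).natAbs : ℤ) = (cube L k x - z) i := Int.natAbs_of_nonneg h.1
    have : (((cube L k x - z) i).natAbs : ℤ) ≤ ((if i = κ then 1 else 0 : ℕ) : ℤ) := by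
      rw [hcast]; push_cast; exact h.2
    exact_mod_cast this
  calc B7Prop1Explicit.l1 (cube L k x - z) = ∑ i, ((cube L k x - z) i).natAbs := rfl
    _ ≤ ∑ i, (if i = κ then 1 else 0 : ℕ) := Finset.sum_le_sum fun i _ => hnat i
    _ = 1 := by rw [Finset.sum_ite_eq']; simp

variable {𝔸 : Type*} [NormedRing 𝔸] [NormedAlgebra ℂ 𝔸]

open Classical in
/-- **The box projection of a coordinate insertion**: `‖P_c(e_a v)‖ ≤ 𝟙[a ∈ B(c)]·‖v‖`. [cite: Balaban1985Averaging, p.24 (after (43))] -/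
theorem norm_boxProj_single_le (S : Finset (B7Prop1Explicit.Site d × Fin d)) (L k : ℕ) (z : B7Prop1Explicit.Site d) (κ : Fin d)
    (a : S) (v : 𝔸) :
    ‖boxProj S L k z κ (Pi.single a v)‖ ≤ (if B7Prop5Flat.BondIn (loK L k z) (bondHiK L k z κ) a.1.1 a.1.2 then 1 else 0) * ‖v‖ := by
  have h0 : (0 : ℝ) ≤ (if B7Prop5Flat.BondIn (loK L k z) (bondHiK L k z κ) a.1.1 a.1.2 then 1 else 0) * ‖v‖ :=
    mul_nonneg (by split_ifs <;> norm_num) (norm_nonneg v)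
  refine (pi_norm_le_iff_of_nonneg h0).2 fun s => ?_
  rw [boxProj_apply]
  by_cases hs : s = a
  · subst hs
    by_cases hB : B7Prop5Flat.BondIn (loK L k z) (bondHiK L k z κ) s.1.1 s.1.2
    · rw [if_pos hB, if_pos hB]; simp
    · rw [if_neg hB, if_neg hB]; simp
  · have : (Pi.single a v : S → 𝔸) s = 0 := by simp [hs]
    rw [this]
    by_cases hB : B7Prop5Flat.BondIn (loK L k z) (bondHiK L k z κ) s.1.1 s.1.2
    · rw [if_pos hB]; simpa using h0
    · rw [if_neg hB]; simpa using h0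

end Geometry

section Generic

variable {E F : Type*} [NormedAddCommGroup E] [NormedSpace ℂ E] [NormedAddCommGroup F] [NormedSpace ℂ F]

/-- Composition with a continuous linear map is differentiable where the outer map is. [folklore] -/
private theorem differentiableAt_comp_clm {f : E → F} (P : E →L[ℂ] E) {X : E} (hd : DifferentiableAt ℂ f (P X)) :
    DifferentiableAt ℂ (f ∘ P) X :=
  hd.comp X P.differentiableAt

end Generic

/-! ## §2 The leaf for the second Fréchet derivative under box smallness -/

section Concrete

variable {d : ℕ}

variable {𝔸 : Type} [NormedRing 𝔸] [NormedAlgebra ℂ 𝔸] [CompleteSpace 𝔸] [NormOneClass 𝔸]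

variable (L : ℕ) (hL : 2 ≤ L) {G : Subgroup 𝔸ˣ} (hG : AvgClosed d L G) (k : ℕ)
  (U₀ : B7Prop1Explicit.Site d → Fin d → 𝔸ˣ) (hU₀ : ∀ x κ, U₀ x κ ∈ G) {α₀ : ℝ} (hα : 0 < α₀)
  (hα3 : C0 d * α₀ ≤ 1 / 3) (hα8 : 8 * α₀ ≤ c2' d L) (h52 : pdev U₀ < α₀ * (((L : ℝ) ^ k)⁻¹) ^ 2)
  (B' : B7Prop1Explicit.Site d → Fin d → 𝔸) {b' : ℝ} (hb' : 0 ≤ b') (hB' : ∀ x κ, ‖B' x κ‖ ≤ b')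
  (hsmall' : Real.exp (4 * (800 * ((d : ℝ) + 1) ^ 2 * ((d : ℝ) + 4)) * α₀)
    * (1 + 8 * (131072 * ((d : ℝ) + 1) ^ 2) * ((L : ℝ) ^ k * b')) ≤ 2)
  (hc₃' : 2 * ((L : ℝ) ^ k * b') ≤ c3 d L) (hb'1 : 409600 * ((d : ℝ) + 1) ^ 2 * ((L : ℝ) ^ k * b') ≤ 1)
  {ρ : ℝ} (hρ : 0 < ρ)
  (hρsmall : Real.exp (4480 * ((d : ℝ) + 1) ^ 2 * ((d : ℝ) + 4) * α₀ + 240000 * ((d : ℝ) + 1) ^ 3 * ((L : ℝ) ^ k * b'))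
    * (1 + 8 * (2097152 * ((d : ℝ) + 1) ^ 2) * ((L : ℝ) ^ k * ρ)) ≤ 2)
  (hρc₃ : 2 * ((L : ℝ) ^ k * ρ) ≤ c3 d L / 4)

include hL hG hU₀ hα hα3 hα8 h52 hb' hB' hsmall' hc₃' hb'1 hρ hρsmall hρc₃ in
/-- **`C_k(U′U₀, ins_S ·)(c)` is differentiable at every centre that is small ON THE BOX** (`‖P_c X‖ < ρ`): locality `C = C ∘ P_c` and Prop. 7
on the ball. [cite: Balaban1985Averaging, Prop. 7 p.43, p.24] -/
theorem differentiableAt_Ck_ins_of_box (S : Finset (B7Prop1Explicit.Site d × Fin d)) (z : B7Prop1Explicit.Site d) (κ : Fin d)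
    {X : S → 𝔸} (hX : ‖boxProj S L k z κ X‖ < ρ) :
    DifferentiableAt ℂ (fun a : S → 𝔸 =>
        logCovIter L (expCfg B' * U₀) (insCfg S a) k z κ - linCovIter L (expCfg B' * U₀) (insCfg S a) k z κ) X := by
  set f := fun a : S → 𝔸 =>
    logCovIter L (expCfg B' * U₀) (insCfg S a) k z κ - linCovIter L (expCfg B' * U₀) (insCfg S a) k z κ with hf
  have hfP : ∀ a, f a = f (boxProj S L k z κ a) := fun a => Ck_ins_eq_boxProj L hL k U₀ B' S z κ a
  have hcomp : f = f ∘ (boxProj S L k z κ) := funext fun a => hfP a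
  have hd : DifferentiableAt ℂ f (boxProj S L k z κ X) :=
    (differentiableOn_Ck_ins L hL hG k U₀ hU₀ hα hα3 hα8 h52 B' hb' hB' hsmall' hc₃' hb'1 hρ hρsmall hρc₃ S z κ).differentiableAt
      (isOpen_ball.mem_nhds (by rwa [mem_ball_zero_iff]))
  rw [hcomp]
  exact differentiableAt_comp_clm (boxProj S L k z κ (𝔸 := 𝔸)) hd

include hL hG hU₀ hα hα3 hα8 h52 hb' hB' hsmall' hc₃' hb'1 hρ hρsmall hρc₃ in
/-- **THE LEAF FOR THE SECOND FRÉCHET DERIVATIVE, BOX CURRENCY**: `‖P_c X‖ < ρ/3 ⟹ ‖D²C_k(U′U₀, ins_S ·)(c)(X) u v‖ ≤ 9C₂‖P_c u‖‖P_c v‖`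
(`HolomorphicBanach.fderiv_fderiv_apply` on the open set `P_c⁻¹{‖·‖ < ρ}` + `B11Ineq189LeafCkLocal.norm_d2_Ck_ins_local`).
[cite: Balaban1985Variational, (189) p.308] [cite: Balaban1985Averaging, Prop. 4 (134)–(135) p.38, Prop. 7 p.43, p.24] -/
theorem norm_fderiv_fderiv_Ck_ins_local (S : Finset (B7Prop1Explicit.Site d × Fin d)) (z : B7Prop1Explicit.Site d) (κ : Fin d)
    {X : S → 𝔸} (hX : ‖boxProj S L k z κ X‖ < ρ / 3) (u v : S → 𝔸) :
    ‖fderiv ℂ (fderiv ℂ (fun a : S → 𝔸 =>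
        logCovIter L (expCfg B' * U₀) (insCfg S a) k z κ - linCovIter L (expCfg B' * U₀) (insCfg S a) k z κ)) X u v‖ ≤
      9 * (8 * (2097152 * ((d : ℝ) + 1) ^ 2)
        * Real.exp (4480 * ((d : ℝ) + 1) ^ 2 * ((d : ℝ) + 4) * α₀ + 240000 * ((d : ℝ) + 1) ^ 3 * ((L : ℝ) ^ k * b'))
        * ((L : ℝ) ^ k) ^ 2) * ‖boxProj S L k z κ u‖ * ‖boxProj S L k z κ v‖ := by
  have hopen : IsOpen ((boxProj S L k z κ (𝔸 := 𝔸)) ⁻¹' ball (0 : S → 𝔸) ρ) := isOpen_ball.preimage (boxProj S L k z κ).continuous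
  have hXU : X ∈ (boxProj S L k z κ (𝔸 := 𝔸)) ⁻¹' ball (0 : S → 𝔸) ρ := by
    show boxProj S L k z κ X ∈ ball (0 : S → 𝔸) ρ
    rw [mem_ball_zero_iff]; linarith [norm_nonneg (boxProj S L k z κ X)]
  have hfU : DifferentiableOn ℂ (fun a : S → 𝔸 =>
      logCovIter L (expCfg B' * U₀) (insCfg S a) k z κ - linCovIter L (expCfg B' * U₀) (insCfg S a) k z κ)
      ((boxProj S L k z κ (𝔸 := 𝔸)) ⁻¹' ball (0 : S → 𝔸) ρ) := fun Y hY => by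
    have hY' : ‖boxProj S L k z κ Y‖ < ρ := by
      have : boxProj S L k z κ Y ∈ ball (0 : S → 𝔸) ρ := hY
      rwa [mem_ball_zero_iff] at this
    exact (differentiableAt_Ck_ins_of_box L hL hG k U₀ hU₀ hα hα3 hα8 h52 B' hb' hB' hsmall' hc₃' hb'1 hρ hρsmall hρc₃ S z κ
      hY').differentiableWithinAt
  rw [Literature.Analysis.Complex.HolomorphicBanach.fderiv_fderiv_apply hfU hopen hXU u v]
  exact norm_d2_Ck_ins_local L hL hG k U₀ hU₀ hα hα3 hα8 h52 B' hb' hB' hsmall' hc₃' hb'1 hρ hρsmall hρc₃ S z κ hX u v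

/-! ## §3 The leaf as a multi-block majorant over the cube geometry -/

open Classical in
include hL in
omit [CompleteSpace 𝔸] [NormOneClass 𝔸] in
/-- **Row sums of the box indicator over one cube**: for a coarse bond `c = (z, κ)` and a cube `y′`, the number of fine bonds of `S` in the box of
`c` whose cube is `y′` is `≤ d(Lᵏ)ᵈ·𝟙[|y′ − z|₁ ≤ 1]`. [cite: Balaban1985Averaging, p.24 (after (43))] -/
theorem sum_boxInd_filter_cube_le (S T' : Finset (B7Prop1Explicit.Site d × Fin d)) (c : T') (y' : (cubeGeometry L k S T').Site) :
    ∑ a ∈ univ.filter (fun a : S => blkS L k S T' a = y'),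
        (if B7Prop5Flat.BondIn (loK L k c.1.1) (bondHiK L k c.1.1 c.1.2) a.1.1 a.1.2 then (1 : ℝ) else 0) ≤
      (d * ((L : ℝ) ^ k) ^ d) * (if B7Prop1Explicit.l1 (Subtype.val y' - c.1.1) ≤ 1 then 1 else 0) := by
  classical
  have hL1 : 1 ≤ L := le_trans (by norm_num) hL
  by_cases hnear : B7Prop1Explicit.l1 (Subtype.val y' - c.1.1) ≤ 1
  · rw [if_pos hnear, mul_one]
    calc ∑ a ∈ univ.filter (fun a : S => blkS L k S T' a = y'),
          (if B7Prop5Flat.BondIn (loK L k c.1.1) (bondHiK L k c.1.1 c.1.2) a.1.1 a.1.2 then (1 : ℝ) else 0)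
        ≤ ∑ a ∈ univ.filter (fun a : S => blkS L k S T' a = y'), (1 : ℝ) :=
          Finset.sum_le_sum fun a _ => by split_ifs <;> norm_num
      _ = ((univ.filter (fun a : S => blkS L k S T' a = y')).card : ℝ) := by rw [Finset.sum_const, nsmul_eq_mul, mul_one]
      _ ≤ ((univ.filter (fun s : S => cube L k s.1.1 = Subtype.val y')).card : ℝ) := by
          refine Nat.cast_le.2 (Finset.card_le_card fun a ha => ?_)
          rw [Finset.mem_filter] at ha ⊢
          exact ⟨ha.1, by rw [← ha.2]; rfl⟩
      _ ≤ d * ((L : ℝ) ^ k) ^ d := by exact_mod_cast card_filter_cube_le hL1 k S (Subtype.val y')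
  · rw [if_neg hnear, mul_zero]
    refine Finset.sum_nonpos fun a ha => ?_
    rw [Finset.mem_filter] at ha
    split_ifs with hB
    · exfalso
      apply hnear
      have hcube : cube L k a.1.1 = Subtype.val y' := by rw [← ha.2]; rfl
      rw [← hcube]
      exact l1_cube_sub_le_one hL1 k c.1.1 c.1.2 hB.1
    · exact le_rfl

include hL hG hU₀ hα hα3 hα8 h52 hb' hB' hsmall' hc₃' hb'1 hρ hρsmall hρc₃ in
/-- **THE (189) LEAF FOR `C_k` AS A MULTI-BLOCK `HasMaj₂`** (census §4 U1/U2 + §5 SHAPE-L, local version): on the single-scale cube geometry of the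
`ℤᵈ` insertion space, for a centre `X` small on every box and any ℝ-bilinear `Φ` agreeing with the second derivative of `C_k(U′U₀, ins_S ·)`,
`HasMaj₂ (supSize g boxS blkS) (supSize g boxS blkS) (supSize g boxT blkT) Φ K` with
`K(y, y″, y′) = 9C₂·(d(Lᵏ)ᵈ·𝟙[|y′ − y|₁ ≤ 1])·(d(Lᵏ)ᵈ·𝟙[|y″ − y|₁ ≤ 1])` — entries from `norm_fderiv_fderiv_Ck_ins_local` on coordinate insertions,
row sums from `sum_boxInd_filter_cube_le`, assembled by `B11Ineq189HasMaj2Kernel.hasMaj₂_supSize_of_kernel`.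
[cite: Balaban1985Variational, (189) p.308] [cite: Balaban1985Averaging, Prop. 4 (134)–(135) p.38, Prop. 7 p.43, p.24] -/
theorem hasMaj₂_d2_Ck_ins (S T' : Finset (B7Prop1Explicit.Site d × Fin d)) {X : S → 𝔸}
    (hX : ∀ c : T', ‖boxProj S L k c.1.1 c.1.2 X‖ < ρ / 3)
    (Φ : (S → 𝔸) →ₗ[ℝ] (S → 𝔸) →ₗ[ℝ] (T' → 𝔸))
    (hΦ : ∀ (v μ : S → 𝔸) (c : T'), Φ v μ c = fderiv ℂ (fderiv ℂ (fun a : S → 𝔸 =>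
        logCovIter L (expCfg B' * U₀) (insCfg S a) k c.1.1 c.1.2 - linCovIter L (expCfg B' * U₀) (insCfg S a) k c.1.1 c.1.2)) X v μ) :
    HasMaj₂ (supSize (cubeGeometry L k S T') (boxS L k S T') (blkS L k S T') : BlockNorm (cubeGeometry L k S T') (S → 𝔸))
      (supSize (cubeGeometry L k S T') (boxS L k S T') (blkS L k S T') : BlockNorm (cubeGeometry L k S T') (S → 𝔸))
      (supSize (cubeGeometry L k S T') (boxT L k S T') (blkT L k S T') : BlockNorm (cubeGeometry L k S T') (T' → 𝔸)) Φ
      (fun y y'' y' =>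
        9 * (8 * (2097152 * ((d : ℝ) + 1) ^ 2)
          * Real.exp (4480 * ((d : ℝ) + 1) ^ 2 * ((d : ℝ) + 4) * α₀ + 240000 * ((d : ℝ) + 1) ^ 3 * ((L : ℝ) ^ k * b'))
          * ((L : ℝ) ^ k) ^ 2) *
        ((d * ((L : ℝ) ^ k) ^ d) * (if B7Prop1Explicit.l1 (Subtype.val y' - Subtype.val y) ≤ 1 then 1 else 0)) *
        ((d * ((L : ℝ) ^ k) ^ d) * (if B7Prop1Explicit.l1 (Subtype.val y'' - Subtype.val y) ≤ 1 then 1 else 0))) := by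
  classical
  -- the constant 9C₂
  set C9 : ℝ := 9 * (8 * (2097152 * ((d : ℝ) + 1) ^ 2)
      * Real.exp (4480 * ((d : ℝ) + 1) ^ 2 * ((d : ℝ) + 4) * α₀ + 240000 * ((d : ℝ) + 1) ^ 3 * ((L : ℝ) ^ k * b'))
      * ((L : ℝ) ^ k) ^ 2) with hC9
  have hC9pos : 0 ≤ C9 := by rw [hC9]; positivity
  -- box indicators are non-negative
  have hind0 : ∀ (c : T') (a : S), (0 : ℝ) ≤ (if B7Prop5Flat.BondIn (loK L k c.1.1) (bondHiK L k c.1.1 c.1.2) a.1.1 a.1.2 then (1 : ℝ) else 0) :=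
    fun c a => by split_ifs <;> norm_num
  refine hasMaj₂_supSize_of_kernel (boxS L k S T') (blkS L k S T') (boxS L k S T') (blkS L k S T') (boxT L k S T') (blkT L k S T')
    (fun s => Finset.mem_filter.2 ⟨Finset.mem_univ _, rfl⟩) (fun s => Finset.mem_filter.2 ⟨Finset.mem_univ _, rfl⟩) Φ
    (fun c a b => C9 * ((if B7Prop5Flat.BondIn (loK L k c.1.1) (bondHiK L k c.1.1 c.1.2) a.1.1 a.1.2 then (1 : ℝ) else 0) * (if B7Prop5Flat.BondIn (loK L k c.1.1) (bondHiK L k c.1.1 c.1.2) b.1.1 b.1.2 then (1 : ℝ) else 0)))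
    (fun c a b => mul_nonneg hC9pos (mul_nonneg (hind0 c a) (hind0 c b)))
    (fun a v b w c => ?_) _ (fun y y'' y' => ?_) (fun y y'' y' c hc => ?_)
  · -- the entry bound: the leaf on coordinate insertions
    rw [hΦ]
    have hleaf := norm_fderiv_fderiv_Ck_ins_local L hL hG k U₀ hU₀ hα hα3 hα8 h52 B' hb' hB' hsmall' hc₃' hb'1 hρ hρsmall hρc₃ S
      c.1.1 c.1.2 (hX c) (Pi.single a v) (Pi.single b w)
    have ha := norm_boxProj_single_le S L k c.1.1 c.1.2 a v
    have hb := norm_boxProj_single_le S L k c.1.1 c.1.2 b w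
    calc _ ≤ C9 * ‖boxProj S L k c.1.1 c.1.2 (Pi.single a v)‖ * ‖boxProj S L k c.1.1 c.1.2 (Pi.single b w)‖ := by
          rw [hC9]; exact hleaf
      _ ≤ C9 * ((if B7Prop5Flat.BondIn (loK L k c.1.1) (bondHiK L k c.1.1 c.1.2) a.1.1 a.1.2 then (1 : ℝ) else 0) * ‖v‖) * ((if B7Prop5Flat.BondIn (loK L k c.1.1) (bondHiK L k c.1.1 c.1.2) b.1.1 b.1.2 then (1 : ℝ) else 0) * ‖w‖) :=
          mul_le_mul (mul_le_mul_of_nonneg_left ha hC9pos) hb (norm_nonneg _)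
            (mul_nonneg hC9pos (mul_nonneg (hind0 c a) (norm_nonneg _)))
      _ = C9 * ((if B7Prop5Flat.BondIn (loK L k c.1.1) (bondHiK L k c.1.1 c.1.2) a.1.1 a.1.2 then (1 : ℝ) else 0) * (if B7Prop5Flat.BondIn (loK L k c.1.1) (bondHiK L k c.1.1 c.1.2) b.1.1 b.1.2 then (1 : ℝ) else 0)) * ‖v‖ * ‖w‖ := by ring
  · positivity
  · -- the joint row sums
    have hcy : (c.1.1 : B7Prop1Explicit.Site d) = Subtype.val y := by
      have := (Finset.mem_filter.1 hc).2
      exact congrArg Subtype.val this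
    have hA := sum_boxInd_filter_cube_le L hL k S T' c y'
    have hB := sum_boxInd_filter_cube_le L hL k S T' c y''
    rw [← hcy]
    have hsumB0 : 0 ≤ ∑ b ∈ univ.filter (fun b : S => blkS L k S T' b = y''), (if B7Prop5Flat.BondIn (loK L k c.1.1) (bondHiK L k c.1.1 c.1.2) b.1.1 b.1.2 then (1 : ℝ) else 0) :=
      Finset.sum_nonneg fun b _ => hind0 c b
    have hNA0 : 0 ≤ (d * ((L : ℝ) ^ k) ^ d) * (if B7Prop1Explicit.l1 (Subtype.val y' - c.1.1) ≤ 1 then (1 : ℝ) else 0) := by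
      positivity
    calc ∑ a ∈ univ.filter (fun a : S => blkS L k S T' a = y'), ∑ b ∈ univ.filter (fun b : S => blkS L k S T' b = y''),
          C9 * ((if B7Prop5Flat.BondIn (loK L k c.1.1) (bondHiK L k c.1.1 c.1.2) a.1.1 a.1.2 then (1 : ℝ) else 0) * (if B7Prop5Flat.BondIn (loK L k c.1.1) (bondHiK L k c.1.1 c.1.2) b.1.1 b.1.2 then (1 : ℝ) else 0))
        = C9 * ((∑ a ∈ univ.filter (fun a : S => blkS L k S T' a = y'), (if B7Prop5Flat.BondIn (loK L k c.1.1) (bondHiK L k c.1.1 c.1.2) a.1.1 a.1.2 then (1 : ℝ) else 0)) *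
            (∑ b ∈ univ.filter (fun b : S => blkS L k S T' b = y''), (if B7Prop5Flat.BondIn (loK L k c.1.1) (bondHiK L k c.1.1 c.1.2) b.1.1 b.1.2 then (1 : ℝ) else 0))) := by
          rw [Finset.sum_mul_sum, Finset.mul_sum]
          simp_rw [Finset.mul_sum]
      _ ≤ C9 * (((d * ((L : ℝ) ^ k) ^ d) * (if B7Prop1Explicit.l1 (Subtype.val y' - c.1.1) ≤ 1 then 1 else 0)) *
            ((d * ((L : ℝ) ^ k) ^ d) * (if B7Prop1Explicit.l1 (Subtype.val y'' - c.1.1) ≤ 1 then 1 else 0))) :=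
          mul_le_mul_of_nonneg_left (mul_le_mul hA hB hsumB0 hNA0) hC9pos
      _ = _ := by ring

include hL hG hU₀ hα hα3 hα8 h52 hb' hB' hsmall' hc₃' hb'1 hρ hρsmall hρc₃ in
/-- **SHAPE-L's printed dress**: the same majorant bounded by `9C₂(d(Lᵏ)ᵈ)²e^{2δ}·e^{−δ d(y, y″)}·e^{−δ d(y, y′)}` for every `δ ≥ 0` (the indicator
of `ℓ¹`-distance ≤ 1 is ≤ `e^{δ}e^{−δ·dist}`; `dist` = the cube geometry's `ℓ¹` distance) — the form *«O(1)·C₂·exp(−δd(y, y′))·exp(−δd(y, y″))»*.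
[cite: Balaban1985Variational, (189) p.308] -/
theorem hasMaj₂_d2_Ck_ins_exp (S T' : Finset (B7Prop1Explicit.Site d × Fin d)) {X : S → 𝔸}
    (hX : ∀ c : T', ‖boxProj S L k c.1.1 c.1.2 X‖ < ρ / 3)
    (Φ : (S → 𝔸) →ₗ[ℝ] (S → 𝔸) →ₗ[ℝ] (T' → 𝔸))
    (hΦ : ∀ (v μ : S → 𝔸) (c : T'), Φ v μ c = fderiv ℂ (fderiv ℂ (fun a : S → 𝔸 =>
        logCovIter L (expCfg B' * U₀) (insCfg S a) k c.1.1 c.1.2 - linCovIter L (expCfg B' * U₀) (insCfg S a) k c.1.1 c.1.2)) X v μ)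
    {δ : ℝ} (hδ : 0 ≤ δ) :
    HasMaj₂ (supSize (cubeGeometry L k S T') (boxS L k S T') (blkS L k S T') : BlockNorm (cubeGeometry L k S T') (S → 𝔸))
      (supSize (cubeGeometry L k S T') (boxS L k S T') (blkS L k S T') : BlockNorm (cubeGeometry L k S T') (S → 𝔸))
      (supSize (cubeGeometry L k S T') (boxT L k S T') (blkT L k S T') : BlockNorm (cubeGeometry L k S T') (T' → 𝔸)) Φ
      (fun y y'' y' =>
        9 * (8 * (2097152 * ((d : ℝ) + 1) ^ 2)
          * Real.exp (4480 * ((d : ℝ) + 1) ^ 2 * ((d : ℝ) + 4) * α₀ + 240000 * ((d : ℝ) + 1) ^ 3 * ((L : ℝ) ^ k * b'))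
          * ((L : ℝ) ^ k) ^ 2) * (d * ((L : ℝ) ^ k) ^ d) ^ 2 * Real.exp (2 * δ) *
        Real.exp (-(δ * (cubeGeometry L k S T').dist y y'')) * Real.exp (-(δ * (cubeGeometry L k S T').dist y y'))) := by
  classical
  refine (hasMaj₂_d2_Ck_ins L hL hG k U₀ hU₀ hα hα3 hα8 h52 B' hb' hB' hsmall' hc₃' hb'1 hρ hρsmall hρc₃ S T' hX Φ hΦ).mono
    fun y y'' y' => ?_
  -- indicator ≤ e^{δ}·e^{−δ·dist}, in each of the two variables
  have key : ∀ w : (cubeGeometry L k S T').Site,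
      (if B7Prop1Explicit.l1 (Subtype.val w - Subtype.val y) ≤ 1 then (1 : ℝ) else 0) ≤
        Real.exp δ * Real.exp (-(δ * (cubeGeometry L k S T').dist y w)) := by
    intro w
    have hdist : (cubeGeometry L k S T').dist y w = (B7Prop1Explicit.l1 (Subtype.val y - Subtype.val w) : ℝ) := rfl
    have hsymm : B7Prop1Explicit.l1 (Subtype.val y - Subtype.val w) = B7Prop1Explicit.l1 (Subtype.val w - Subtype.val y) := by
      unfold B7Prop1Explicit.l1
      refine Finset.sum_congr rfl fun i _ => ?_
      rw [show (Subtype.val y - Subtype.val w : B7Prop1Explicit.Site d) i = -((Subtype.val w - Subtype.val y : B7Prop1Explicit.Site d) i)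
        from by simp [Pi.sub_apply], Int.natAbs_neg]
    split_ifs with h
    · rw [← Real.exp_add]
      have : (0 : ℝ) ≤ δ + -(δ * (cubeGeometry L k S T').dist y w) := by
        rw [hdist, hsymm]
        have h1 : (B7Prop1Explicit.l1 (Subtype.val w - Subtype.val y) : ℝ) ≤ 1 := by exact_mod_cast h
        nlinarith
      calc (1 : ℝ) = Real.exp 0 := (Real.exp_zero).symm
        _ ≤ _ := Real.exp_le_exp.2 this
    · positivity
  have h1 := key y'
  have h2 := key y''
  have hN : (0 : ℝ) ≤ d * ((L : ℝ) ^ k) ^ d := by positivity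
  have hC : (0 : ℝ) ≤ 9 * (8 * (2097152 * ((d : ℝ) + 1) ^ 2)
      * Real.exp (4480 * ((d : ℝ) + 1) ^ 2 * ((d : ℝ) + 4) * α₀ + 240000 * ((d : ℝ) + 1) ^ 3 * ((L : ℝ) ^ k * b'))
      * ((L : ℝ) ^ k) ^ 2) := by positivity
  have hi1 : (0 : ℝ) ≤ (if B7Prop1Explicit.l1 (Subtype.val y' - Subtype.val y) ≤ 1 then (1 : ℝ) else 0) := by positivity
  calc 9 * (8 * (2097152 * ((d : ℝ) + 1) ^ 2)
          * Real.exp (4480 * ((d : ℝ) + 1) ^ 2 * ((d : ℝ) + 4) * α₀ + 240000 * ((d : ℝ) + 1) ^ 3 * ((L : ℝ) ^ k * b'))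
          * ((L : ℝ) ^ k) ^ 2) *
        ((d * ((L : ℝ) ^ k) ^ d) * (if B7Prop1Explicit.l1 (Subtype.val y' - Subtype.val y) ≤ 1 then 1 else 0)) *
        ((d * ((L : ℝ) ^ k) ^ d) * (if B7Prop1Explicit.l1 (Subtype.val y'' - Subtype.val y) ≤ 1 then 1 else 0))
      ≤ 9 * (8 * (2097152 * ((d : ℝ) + 1) ^ 2)
          * Real.exp (4480 * ((d : ℝ) + 1) ^ 2 * ((d : ℝ) + 4) * α₀ + 240000 * ((d : ℝ) + 1) ^ 3 * ((L : ℝ) ^ k * b'))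
          * ((L : ℝ) ^ k) ^ 2) *
        ((d * ((L : ℝ) ^ k) ^ d) * (Real.exp δ * Real.exp (-(δ * (cubeGeometry L k S T').dist y y')))) *
        ((d * ((L : ℝ) ^ k) ^ d) * (Real.exp δ * Real.exp (-(δ * (cubeGeometry L k S T').dist y y'')))) := by
          refine mul_le_mul (mul_le_mul_of_nonneg_left (mul_le_mul_of_nonneg_left h1 hN) hC)
            (mul_le_mul_of_nonneg_left h2 hN) (by positivity) (by positivity)
    _ = _ := by
          have : Real.exp (2 * δ) = Real.exp δ * Real.exp δ := by rw [← Real.exp_add]; ring_nf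
          rw [this]; ring

include hL hG hU₀ hα hα3 hα8 h52 hb' hB' hsmall' hc₃' hb'1 hρ hρsmall hρc₃ in
/-- **THE LEAF, PACKAGED**: the second derivatives `D²C_k(U′U₀, ins_S ·)(c)(X)`, `c ∈ T′`, ASSEMBLE into an ℝ-bilinear family
`Φ : 𝔸^S × 𝔸^S → 𝔸^{T′}` (bilinearity of the second Fréchet derivative), which therefore carries the multi-block majorant of `hasMaj₂_d2_Ck_ins` —
the hypothesis-free form a consumer `obtain`s. [cite: Balaban1985Variational, (189) p.308] [cite: Balaban1985Averaging, Prop. 4 (134)–(135) p.38, Prop. 7 p.43] -/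
theorem exists_hasMaj₂_d2_Ck_ins (S T' : Finset (B7Prop1Explicit.Site d × Fin d)) {X : S → 𝔸}
    (hX : ∀ c : T', ‖boxProj S L k c.1.1 c.1.2 X‖ < ρ / 3) :
    ∃ Φ : (S → 𝔸) →ₗ[ℝ] (S → 𝔸) →ₗ[ℝ] (T' → 𝔸),
      (∀ (v μ : S → 𝔸) (c : T'), Φ v μ c = fderiv ℂ (fderiv ℂ (fun a : S → 𝔸 =>
        logCovIter L (expCfg B' * U₀) (insCfg S a) k c.1.1 c.1.2 - linCovIter L (expCfg B' * U₀) (insCfg S a) k c.1.1 c.1.2)) X v μ) ∧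
      HasMaj₂ (supSize (cubeGeometry L k S T') (boxS L k S T') (blkS L k S T') : BlockNorm (cubeGeometry L k S T') (S → 𝔸))
        (supSize (cubeGeometry L k S T') (boxS L k S T') (blkS L k S T') : BlockNorm (cubeGeometry L k S T') (S → 𝔸))
        (supSize (cubeGeometry L k S T') (boxT L k S T') (blkT L k S T') : BlockNorm (cubeGeometry L k S T') (T' → 𝔸)) Φ
        (fun y y'' y' =>
          9 * (8 * (2097152 * ((d : ℝ) + 1) ^ 2)
            * Real.exp (4480 * ((d : ℝ) + 1) ^ 2 * ((d : ℝ) + 4) * α₀ + 240000 * ((d : ℝ) + 1) ^ 3 * ((L : ℝ) ^ k * b'))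
            * ((L : ℝ) ^ k) ^ 2) *
          ((d * ((L : ℝ) ^ k) ^ d) * (if B7Prop1Explicit.l1 (Subtype.val y' - Subtype.val y) ≤ 1 then 1 else 0)) *
          ((d * ((L : ℝ) ^ k) ^ d) * (if B7Prop1Explicit.l1 (Subtype.val y'' - Subtype.val y) ≤ 1 then 1 else 0))) := by
  classical
  -- the family of second derivatives, one continuous bilinear map per coarse bond
  set D2 : T' → (S → 𝔸) →L[ℂ] (S → 𝔸) →L[ℂ] 𝔸 := fun c => fderiv ℂ (fderiv ℂ (fun a : S → 𝔸 =>
      logCovIter L (expCfg B' * U₀) (insCfg S a) k c.1.1 c.1.2 - linCovIter L (expCfg B' * U₀) (insCfg S a) k c.1.1 c.1.2)) X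
    with hD2
  let Φ : (S → 𝔸) →ₗ[ℝ] (S → 𝔸) →ₗ[ℝ] (T' → 𝔸) :=
    LinearMap.mk₂ ℝ (fun v μ => fun c => D2 c v μ)
      (fun v₁ v₂ μ => funext fun c => by
        show D2 c (v₁ + v₂) μ = D2 c v₁ μ + D2 c v₂ μ
        rw [map_add]; rfl)
      (fun r v μ => funext fun c => by
        show D2 c (r • v) μ = r • D2 c v μ
        rw [ContinuousLinearMap.map_smul_of_tower]; rfl)
      (fun v μ₁ μ₂ => funext fun c => by
        show D2 c v (μ₁ + μ₂) = D2 c v μ₁ + D2 c v μ₂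
        exact map_add _ _ _)
      (fun r v μ => funext fun c => by
        show D2 c v (r • μ) = r • D2 c v μ
        exact ContinuousLinearMap.map_smul_of_tower _ _ _)
  have hΦ : ∀ (v μ : S → 𝔸) (c : T'), Φ v μ c = D2 c v μ := fun v μ c => rfl
  refine ⟨Φ, fun v μ c => by rw [hΦ], ?_⟩
  exact hasMaj₂_d2_Ck_ins L hL hG k U₀ hU₀ hα hα3 hα8 h52 B' hb' hB' hsmall' hc₃' hb'1 hρ hρsmall hρc₃ S T' hX Φ
    (fun v μ c => by rw [hΦ])

end Concrete

end Literature.MathematicalPhysics.QuantumFieldTheory.Balaban1983to89.B11Ineq189LeafCkHasMaj2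

end
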